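import Literature.NumberTheory.Rogawski1990.UnitOrbitalIntegralInertValueThetaZeroTrichotomy
import Literature.NumberTheory.Automorphic.HyperspecialUnitaryCartanAdicCompletion        -- ★ `localConjDatum_adicCompletion`
import Literature.NumberTheory.Automorphic.UnitaryGroupIntegralPointsReductionInert       -- ★ `natCard_residueField_eq_sq_of_inert`, `mem_integer_galAdicCompletionMap`
import Literature.NumberTheory.LocalFields.UnramifiedQuadraticNormAtInertPlace           -- ★ `exists_isUnit_map_sub_of_residueHom_ne`
import Literature.LinearAlgebra.Matrix.FiniteFieldHermitianAnisotropic                    -- ★ `exists_frob_ne`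
import Literature.NumberTheory.Automorphic.LocalUnitaryGroupCongr                         -- ★ `antidiagOne_eq_over`, `localNonsplitEquiv`
import HarnessLib

-- Pen: F0P3a-p04 (g12) over F0P3b-p01 (g6)'s final-cycle draft (statement, `hJ`, `hd` his; the `ValuativeRel` ↔ `Valued` integer-ring bridge here).

/-!
# The `θ̄ = 0` value AT THE INERT COMPLETION `L_w`: `#Fix_{U(L_w)⧸K}(t(a,b,c)) = φ₀(N₁, N₂, N)` with `q = Nv`, the local frame data discharged
(Flicker (1998), *Elementary proof of the fundamental lemma for a unitary group*, Prop. 14 p. 94; Rogawski (1990) §4.9)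

Topic `NumberTheory/Rogawski1990` (road «D-N7-inert», MAP v3 LAYER C → (F12) value stub `X₁`, layer (ii-b)); namespace `Literature.NumberTheory.Automorphic.UnitaryGroup`.
THEOREMS ONLY; kernel lane.  Pen F0P3b-p01 (g6) (p04 (g12) 06:36:56Z «YOURS»).  HONEST LABEL: HC_CM is proved only modulo the 2 remaining named inputs (hLiu418, h413)
until rung 0 closes.

`natCard_fixedPoints_unitaryInt_corner_eq_phiZero_adicCompletion`: at `K = L_w` (`w ∣ v` inert, `v` unramified, `2 ∉ v`), `σ_w = galAdicCompletionMap`, `J_w = placeForm Φ₃ w`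
(= `(StdForm.antidiagonal 3).over L_w`, ★ `antidiagOne_eq_over` + `StdForm.over_map`), the hypotheses `hJ hd hσO hq ha₀` of ★ `natCard_fixedPoints_unitaryInt_corner_eq_phiZero_of_tri`
are DISCHARGED (★ `localConjDatum_adicCompletion`, ★ `mem_integer_galAdicCompletionMap`, ★ `natCard_residueField_eq_sq_of_inert`, ★ `exists_isUnit_map_sub_of_residueHom_ne` ∘
★ `exists_frob_ne` ∘ ★ `residueHom_galAdicCompletionMap_eq_pow` — p04 (g12)'s recipe of ★ `UnitStableOrbitalIntegralHSideValue`); what remains: `y` (`y σ_w y = −2`), the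
corner literal `t` with norm-one `a, b, c` and `2e = 1`, the three orders with the trichotomy, `hfin`; the value is `phiZero (Ideal.absNorm v.asIdeal) N₁ N₂ N`.

## References
* [Flicker1998UnitaryFL] Y. Z. Flicker, *Elementary proof of the fundamental lemma for a unitary group*, Canad. J. Math. 50 (1998), 74–98.
* [Rogawski1990] J. D. Rogawski, *Automorphic Representations of Unitary Groups in Three Variables* (1990), §4.9 p. 55.
-/

set_option autoImplicit false

open scoped MatrixGroups WithZero Valued
open Matrix NumberField IsDedekindDomain

namespace Literature.NumberTheory.Automorphic

namespace UnitaryGroup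

open Literature.NumberTheory.Automorphic.HermitianLattice (unitaryInt mem_unitaryInt_iff LocalConjDatum)
open Literature.NumberTheory.Rogawski1990.Flicker1998 (phiZero)
open IsLocalRing

section AdicCompletion

variable (L : Type) [Field L] [NumberField L] [IsCMField L] {v : HeightOneSpectrum (𝓞 ↥(maximalRealSubfield L))}

set_option synthInstance.maxHeartbeats 200000 in
-- the `H`-action on `H ⧸ (K^{u_m} ∩ H)` (as in ★ (F2))
/-- **`#Fix_{U(L_w)⧸K}(t(a,b,c)) = φ₀(N₁,N₂,N)` at an inert place, `q = Nv`** (frame data discharged; see the module docstring).  ONE INSTANCE BINDER is carried: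
`[IsAdicComplete 𝓂[𝒪_w] 𝒪_w]` for the `Valued` integers of `L_w` (mathematically: `𝒪_w` is `𝔪`-adically complete; Mathlib provides it through
`IsNonarchimedeanLocalField`, whose `Valued` structure is not syntactically the adic one — the payer supplies the instance).
[cite: Flicker1998UnitaryFL, Prop. 14 p. 94] [cite: Rogawski1990, §4.9 Prop. 4.9.1 (b) p. 55] -/
theorem natCard_fixedPoints_unitaryInt_corner_eq_phiZero_adicCompletion (w : PlacesOver L v) (hw : IsCMField.complexConj L • w.1 = w.1)
    [IsAdicComplete (IsLocalRing.maximalIdeal 𝒪[w.1.adicCompletion L]) 𝒪[w.1.adicCompletion L]]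
    (hv : Algebra.IsUnramifiedIn (𝓞 L) v.asIdeal) (h2 : (2 : 𝓞 ↥(maximalRealSubfield L)) ∉ v.asIdeal)
    {y : w.1.adicCompletion L} (hy : y * galAdicCompletionMap (L := L) (IsCMField.complexConj L) hw y = -2)
    {e a b cc : w.1.adicCompletion L} (h2e : 2 * e = 1) (ha : galAdicCompletionMap (L := L) (IsCMField.complexConj L) hw a * a = 1)
    (hb : galAdicCompletionMap (L := L) (IsCMField.complexConj L) hw b * b = 1) (hcc : galAdicCompletionMap (L := L) (IsCMField.complexConj L) hw cc * cc = 1)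
    {t : ↥(unitaryGroupOfForm (galAdicCompletionMap (L := L) (IsCMField.complexConj L) hw)
      (placeForm (Matrix.of fun i j : Fin 3 => if i.val + j.val + 1 = 3 then (1 : L) else 0) w.1))}
    (hte : ((t : GL (Fin 3) (w.1.adicCompletion L)) : Matrix (Fin 3) (Fin 3) (w.1.adicCompletion L)) =
      !![e * (a + cc), 0, -(e * (a - cc)); 0, b, 0; -(e * (a - cc)), 0, e * (a + cc)])
    {N N₁ N₂ : ℕ} (hN : Valued.v (a - cc) = WithZero.exp (-(N : ℤ))) (hN₁ : Valued.v (a - b) = WithZero.exp (-(N₁ : ℤ)))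
    (hN₂ : Valued.v (cc - b) = WithZero.exp (-(N₂ : ℤ)))
    (htri : (N₁ = N₂ ∧ N₁ ≤ N) ∨ (N₁ = N ∧ N₁ ≤ N₂) ∨ (N₂ = N ∧ N₂ ≤ N₁))
    (hfin : {x : ↥(unitaryGroupOfForm (galAdicCompletionMap (L := L) (IsCMField.complexConj L) hw)
        (placeForm (Matrix.of fun i j : Fin 3 => if i.val + j.val + 1 = 3 then (1 : L) else 0) w.1)) ⧸
      unitaryInt (galAdicCompletionMap (L := L) (IsCMField.complexConj L) hw)
        (placeForm (Matrix.of fun i j : Fin 3 => if i.val + j.val + 1 = 3 then (1 : L) else 0) w.1) | t • x = x}.Finite) :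
    (Nat.card {x : ↥(unitaryGroupOfForm (galAdicCompletionMap (L := L) (IsCMField.complexConj L) hw)
        (placeForm (Matrix.of fun i j : Fin 3 => if i.val + j.val + 1 = 3 then (1 : L) else 0) w.1)) ⧸
      unitaryInt (galAdicCompletionMap (L := L) (IsCMField.complexConj L) hw)
        (placeForm (Matrix.of fun i j : Fin 3 => if i.val + j.val + 1 = 3 then (1 : L) else 0) w.1) | t • x = x} : ℚ) =
      phiZero (Ideal.absNorm v.asIdeal) N₁ N₂ N := by
  classical
  have hc1 : IsCMField.complexConj L ≠ 1 := IsCMField.complexConj_ne_one L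
  -- `J_w` is the antidiagonal form over `L_w`
  have hJ : placeForm (Matrix.of fun i j : Fin 3 => if i.val + j.val + 1 = 3 then (1 : L) else 0) w.1 =
      (StdForm.antidiagonal 3).over (w.1.adicCompletion L) := by
    rw [placeForm, antidiagOne_eq_over, StdForm.over_map]
  -- the local conjugation datum, `σ_w` on `𝒪`
  obtain ⟨ϖ, hd⟩ := localConjDatum_adicCompletion (IsCMField.complexConj L) hc1 v w hw hv h2
  -- THE CURRENCY BRIDGE: the `ValuativeRel` integers (home of ★ `mem_integer_galAdicCompletionMap`, ★ `natCard_residueField_eq_sq_of_inert`,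
  -- ★ `exists_isUnit_map_sub_of_residueHom_ne`) and the `Valued` integers `𝒪[L_w]` of the Flicker frame are the same subring of `L_w`
  have hO : (ValuativeRel.valuation (w.1.adicCompletion L)).integer = 𝒪[w.1.adicCompletion L] := by
    rw [integer_valuation_eq_adicCompletionIntegers]
    ext x
    simp only [ValuationSubring.mem_toSubring, HeightOneSpectrum.mem_adicCompletionIntegers, Valued.integer, Valuation.mem_integer_iff]
  have hmem : ∀ x : w.1.adicCompletion L, x ∈ (ValuativeRel.valuation (w.1.adicCompletion L)).integer ↔ x ∈ 𝒪[w.1.adicCompletion L] :=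
    fun x => by rw [hO]
  let eO : ↥(ValuativeRel.valuation (w.1.adicCompletion L)).integer ≃+* ↥𝒪[w.1.adicCompletion L] := RingEquiv.subringCongr hO
  have hσO' : ∀ x : ↥(ValuativeRel.valuation (w.1.adicCompletion L)).integer,
      galAdicCompletionMap (L := L) (IsCMField.complexConj L) hw x ∈ (ValuativeRel.valuation (w.1.adicCompletion L)).integer :=
    mem_integer_galAdicCompletionMap (IsCMField.complexConj L) v w hw
  have hσO : ∀ x : 𝒪[w.1.adicCompletion L], galAdicCompletionMap (L := L) (IsCMField.complexConj L) hw x ∈ 𝒪[w.1.adicCompletion L] :=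
    fun x => (hmem _).1 (hσO' ⟨x, (hmem _).2 x.2⟩)
  let σR : ↥(ValuativeRel.valuation (w.1.adicCompletion L)).integer →+* ↥(ValuativeRel.valuation (w.1.adicCompletion L)).integer :=
    ((galAdicCompletionMap (L := L) (IsCMField.complexConj L) hw).comp (ValuativeRel.valuation (w.1.adicCompletion L)).integer.subtype).codRestrict
      (ValuativeRel.valuation (w.1.adicCompletion L)).integer fun x => hσO' x
  let σO : 𝒪[w.1.adicCompletion L] →+* 𝒪[w.1.adicCompletion L] :=
    ((galAdicCompletionMap (L := L) (IsCMField.complexConj L) hw).comp (𝒪[w.1.adicCompletion L]).subtype).codRestrict 𝒪[w.1.adicCompletion L] fun x => hσO x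
  -- `|𝓀_w| = q²` (counted in the `ValuativeRel` presentation, moved by `eO`)
  have hqR := natCard_residueField_eq_sq_of_inert (IsCMField.complexConj L) v hc1 hv w hw
  have hq : Nat.card (ResidueField 𝒪[w.1.adicCompletion L]) = Ideal.absNorm v.asIdeal ^ 2 := by
    rw [← Nat.card_congr (IsLocalRing.ResidueField.mapEquiv eO).toEquiv, hqR, Ideal.absNorm_apply, Submodule.cardQuot_apply]
  -- an integer moved by a unit (found in the `ValuativeRel` presentation, moved by `eO`)
  obtain ⟨σk, hσk⟩ := exists_residueField_ringHom_galAdicCompletionMap (IsCMField.complexConj L) v w hw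
  letI : Fintype (ResidueField ↥(ValuativeRel.valuation (w.1.adicCompletion L)).integer) := Fintype.ofFinite _
  have hq' : Fintype.card (ResidueField ↥(ValuativeRel.valuation (w.1.adicCompletion L)).integer) = Nat.card (𝓞 ↥(maximalRealSubfield L) ⧸ v.asIdeal) ^ 2 := by
    rw [← Nat.card_eq_fintype_card, hqR]
  obtain ⟨a₀, ha₀⟩ := LocalFields.UnramifiedQuadraticNorm.exists_isUnit_map_sub_of_residueHom_ne
    (galAdicCompletionMap (L := L) (IsCMField.complexConj L) hw) (fun x => hσO' x) σk hσk
    (Literature.LinearAlgebra.Matrix.exists_frob_ne hq' σk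
      (residueHom_galAdicCompletionMap_eq_pow (IsCMField.complexConj L) v hc1 hv w hw σk (fun x => hσO' x) hσk))
  have ha₀' : IsUnit (σO (eO a₀) - eO a₀) := by
    have h := (ha₀ : IsUnit (σR a₀ - a₀)).map eO
    rw [map_sub] at h
    convert h using 2
    exact Subtype.ext rfl
  exact natCard_fixedPoints_unitaryInt_corner_eq_phiZero_of_tri (galAdicCompletionMap (L := L) (IsCMField.complexConj L) hw) hJ hd (fun x => hσO x) hy hq
    (a₀ := eO a₀) ha₀' h2e ha hb hcc hte hN hN₁ hN₂ htri hfin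

end AdicCompletion

end UnitaryGroup

end Literature.NumberTheory.Automorphic
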